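import Summits.HodgeConjecture.HodgeConjecture.Theses.CurveNetMordellWeil
import Literature.AlgebraicGeometry.HodgeTheory.VanishingCohomologyNontrivialProofs
import Literature.AlgebraicGeometry.HodgeTheory.HolomorphicBundleChernCharacterTopDegree
import Literature.AlgebraicTopology.SingularHomology.CupProduct

/-!
# Skeleton — crux stmt-HodgeConjecture-2782 `VerticalSupportMiddle`, line `Sketch` (lead reshape)

Line `Sketch` = `Cruxes/VerticalSupportMiddle/Lines/IdeatorTwoSketch.lean` (ideator 2): Part A is the
card `vertical-span-duality` (Poincaré-dual DETECTION form of the crux), Part B the card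
`koszul-bott-interior-vanishing` (a `decide`d Borel–Weil–Bott certificate, no typed bridge to the
crux). The ideator's file has no `stub_*` / `_of` composition; this is the lead's reshape of Part A
into a registered skeleton:

* `stub_orthogonalDetection` — the crux in ORTHOGONAL-DETECTION form: on a smooth projective
  `2q`-fold `X` with a surjection `pr : X ⟶ ℙ^{2q-1}` (`q ≥ 2`), a class `x` in the `ℂ`-span of the
  rational `(q,q)`-classes whose cup product with EVERY vertical rational `(q,q)`-class (one dying
  off `pr⁻¹T` for some proper Zariski-closed `T ⊊ ℙ^{2q-1}`) vanishes in `H^{4q}(X(ℂ); ℂ)` is zero.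
  This is the card's `VerticalDetection` after the duality flip (F1) — and it is the HARD stub: by
  BFNP (6.1) (`hodgeClasses_cupPairing_nondegenerate`) it is equivalent to the crux itself.
* `VerticalSupportMiddle_of` — PROVED composition (pure linear algebra on the real carriers):
  `H := span{rational (q,q)}` and `V := span{vertical rational (q,q)} ≤ H` are finite-dimensional
  (`finite_complexBetti`), `H^{4q}(X(ℂ); ℂ)` is a line (`finrank_complexBetti_two_mul_eq_one`), and the
  stub says `x ↦ (v ↦ x ∪ v) : H → Hom(V, H^{4q})` is injective; hence `dim H ≤ dim V · 1`, so
  `V = H`, so `H ≤ algebraicClasses X q ⊔ V`.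
-/

noncomputable section

set_option linter.dupNamespace false

open CategoryTheory AlgebraicGeometry
open Literature.AlgebraicGeometry Literature.AlgebraicGeometry.Motives
  Literature.AlgebraicGeometry.HodgeTheory Literature.AlgebraicTopology.SingularHomology
open Summit.HodgeConjecture.HodgeConjecture.Theses.CurveNetMordellWeil (VerticalSupportMiddle)

namespace Summit.HodgeConjecture.HodgeConjecture.Theorems

/-- **Orthogonal detection** (line `Sketch`, card `vertical-span-duality`, (F1) dual form of the crux):
for `X` smooth projective of dimension `2q ≥ 4` and `pr : X ⟶ ℙ^{2q-1}` surjective, a class `x` in the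
`ℂ`-span of the rational `(q,q)`-classes with `x ∪ v = 0 ∈ H^{4q}(X(ℂ); ℂ)` for every rational
`(q,q)`-class `v` that dies off `pr⁻¹T` for some proper Zariski-closed `T ⊊ ℙ^{2q-1}` is zero. -/
def VerticalOrthogonalDetection : Prop :=
  ∀ ⦃q m : ℕ⦄ ⦃X : SchemeOver ℂ⦄ (pr : X ⟶ projectiveSpace m ℂ),
    IsSmoothProjective (2 * q) X → 2 ≤ q → m + 1 = 2 * q → Function.Surjective pr.left.base →
    ∀ x ∈ Submodule.span ℂ {c : complexBetti X (2 * q) |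
        IsRationalClass c ∧ IsOfHodgeType (2 * q) X (2 * q) q q c},
      (∀ v : complexBetti X (2 * q), IsRationalClass v → IsOfHodgeType (2 * q) X (2 * q) q q v →
        (∃ T : Set (projectiveSpace m ℂ).left, IsClosed T ∧ T ≠ Set.univ ∧
          complexBetti.restrictCompl X (pr.left.base ⁻¹' T) (2 * q) v = 0) →
        cupProduct (two_mul (2 * q)).symm x v = 0) →
      x = 0

/-- STUB (the hard one; held by the lead): orthogonal detection. Equivalent to the crux by BFNP (6.1). -/
theorem stub_orthogonalDetection : VerticalOrthogonalDetection := by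
  sorry

/-- **Composition: orthogonal detection ⟹ the crux.** Linear algebra: with
`H = span{rational (q,q)}`, `V = span{vertical rational (q,q)} ≤ H` (finite-dimensional) and
`dim H^{4q}(X(ℂ); ℂ) = 1`, the stub makes `H → Hom(V, H^{4q})`, `x ↦ (v ↦ x ∪ v)`, injective, so
`dim H ≤ dim V`, `V = H`, and `H ≤ algebraicClasses X q ⊔ V`. -/
theorem verticalSupportMiddle_of_orthogonalDetection (h : VerticalOrthogonalDetection) :
    VerticalSupportMiddle := by
  intro q m X pr hX hq hm hsurj
  -- the two spans
  set H : Submodule ℂ (complexBetti X (2 * q)) := Submodule.span ℂ {c : complexBetti X (2 * q) |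
      IsRationalClass c ∧ IsOfHodgeType (2 * q) X (2 * q) q q c} with hHdef
  set V : Submodule ℂ (complexBetti X (2 * q)) := Submodule.span ℂ {c : complexBetti X (2 * q) |
      IsRationalClass c ∧ IsOfHodgeType (2 * q) X (2 * q) q q c ∧
        ∃ T : Set (projectiveSpace m ℂ).left, IsClosed T ∧ T ≠ Set.univ ∧
          complexBetti.restrictCompl X (pr.left.base ⁻¹' T) (2 * q) c = 0} with hVdef
  -- it suffices that `H ≤ V`
  suffices hHV : H ≤ V from hHV.trans le_sup_right
  have hVH : V ≤ H := Submodule.span_mono fun c hc ↦ ⟨hc.1, hc.2.1⟩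
  -- finite-dimensionality and the top degree
  haveI : Module.Finite ℂ (complexBetti X (2 * q)) := finite_complexBetti hX (2 * q)
  haveI : Module.Finite ℂ (complexBetti X (2 * (2 * q))) := finite_complexBetti hX (2 * (2 * q))
  have htop : Module.finrank ℂ (complexBetti X (2 * (2 * q))) = 1 :=
    finrank_complexBetti_two_mul_eq_one hX
  -- the pairing `H → Hom(V, H^{4q})`
  let Φ : H →ₗ[ℂ] V →ₗ[ℂ] complexBetti X (2 * (2 * q)) :=
    (cupProduct (two_mul (2 * q)).symm).domRestrict₁₂ H V
  have hΦ : Function.Injective Φ := by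
    rw [← LinearMap.ker_eq_bot, Submodule.eq_bot_iff]
    intro x hx
    rw [LinearMap.mem_ker] at hx
    have hx0 : (x : complexBetti X (2 * q)) = 0 := by
      refine h pr hX hq hm hsurj x x.2 fun v hv hvH hvT ↦ ?_
      have hvV : v ∈ V := Submodule.subset_span ⟨hv, hvH, hvT⟩
      have := LinearMap.congr_fun hx ⟨v, hvV⟩
      simpa [Φ, LinearMap.domRestrict₁₂_apply] using this
    exact Subtype.ext hx0
  have hdim : Module.finrank ℂ H ≤ Module.finrank ℂ V := by
    have h1 := LinearMap.finrank_le_finrank_of_injective hΦ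
    rwa [Module.finrank_linearMap, htop, mul_one] at h1
  exact (Submodule.eq_of_le_of_finrank_le hVH hdim).ge

/-- **The line's composition**: the crux `VerticalSupportMiddle` from its single stub
`stub_orthogonalDetection` (closed modulo that stub). -/
theorem VerticalSupportMiddle_of : VerticalSupportMiddle :=
  verticalSupportMiddle_of_orthogonalDetection stub_orthogonalDetection

end Summit.HodgeConjecture.HodgeConjecture.Theorems

end
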